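import Summits.CriticalPhenomena.PercolationContinuityZ3.Theorems.Transplant.FKConnectivityAllQEdgeMono
import HarnessLib

/-!
# Connectivity correlation inequalities for `φ_{w,q}`, every `q > 0` — file 5a: the toggle `ω ↦ ω ∆ {e}` and the MASTER IDENTITY
# relating the covariance of two edges to the single-edge increment of a connection probability

Support file (`--supports stmt-CriticalPhenomena-4575`), FK sub-lane `prim-bschramm-fk-2` (gen 6) of the post-continuity
programme; builds on p205010 (kernel theorem, internal audit signed; external expert review pending).  No definitions, no named
facts, no sorries; standard axioms.  Tools for `…FKConnectivityAllQEdgeNegCorr.lean` (EC⁺ ⟺ edge-negative association for `q < 1`).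

PROVED HERE (kernel; masses `S_w(E) = ∑_ω w_q(ω) 1_E(ω)`, `J_e = {ω | e ∈ ω}`):
* `FK.rcWeightW_update_one_insert` (any `q ≠ 0`): opening the pair `e = s(x,y)` multiplies the weight by `1` or `q⁻¹` according as
  `x ↔ y` already holds or not; `FK.sum_rcWeightW_update_one_eq_toggle`: for every event `F` not depending on `e`,
  `S_{w[e↦1]}(F) = S_{w[e↦0]}(F) + (q⁻¹ − 1)·S_{w[e↦0]}(F ∩ {x ↮ y})` (substitution `ω ↦ ω ∆ {e}`); the case `F = univ`
  `FK.rcPartitionFunctionW_update_one_eq_toggle`.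
* **`FK.negCorr_defect_eq`** (MASTER IDENTITY, any `q ≠ 0`): with `c = w e`, `d = w f`, `e = s(x,y)`, `f ≠ e`,
  `S_w(J_e ∩ J_f)·Z_w − S_w(J_e)·S_w(J_f) = c(1−c)·d(1−d)·(q⁻¹ − 1)·[S_{w[e↦0][f↦1]}(x↮y)·Z_{w[e↦0][f↦0]} − S_{w[e↦0][f↦0]}(x↮y)·Z_{w[e↦0][f↦1]}]`
  — the covariance of two edges is a multiple, positive for `q < 1`, of MINUS the single-edge increment of the connection
  probability `φ(x ↔ y)` in the state with `e` closed (for the arboreal gas this is the equivalence 'negative correlation for all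
  weights ⟺ all connection probabilities increasing in all weights' stated in Bauerschmidt–Helmuth's survey, §5.2).
* `FK.compl_openConn_mass_eq`, `FK.compl_openConn_mono_lift`: `S_w(x↮y) = (1−c)·S_{w[e↦0]}(x↮y)`, `Z_w = Z_{w[e↦0]} + c(q⁻¹−1)·S_{w[e↦0]}(x↮y)`,
  and the lift of single-edge monotonicity from the state `w[e↦0]` to `w`; `FK.edgeConnMono_iff_compl_mass`.
[cite: Grimmett2006, §3.9 eq. (3.94) (pp. 63–64); Thm. (3.1)(a) (p. 37); §1.4 eq. (1.20) (p. 15)]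
[cite: AyyerLinussonRavichandran2025, §7 eq. (13)–(17) (pp. 22–23)]
-/

noncomputable section

namespace Summit.CriticalPhenomena.PercolationContinuityZ3.Theorems

namespace FK

open MeasureTheory Set Literature.Probability.LatticeModels Literature.Probability.Percolation
open Literature.Probability.Percolation.DecisionTree (ind ind_of_mem ind_of_not_mem ind_nonneg)
open Literature.Probability.Percolation.TwoAvoidanceSets (ind_mul_ind)
open scoped Classical symmDiff

variable {V : Type*} [Fintype V]

/-! ### Mass bookkeeping -/

/-- `S_w(Eᶜ) = Z_w − S_w(E)`. [cite: Grimmett2006, §1.4 eq. (1.20) (p. 15)] -/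
theorem sum_rcWeightW_ind_compl (w : Sym2 V → unitInterval) (q : ℝ) (E : Set (BondConfig V)) :
    ∑ ω : BondConfig V, rcWeightW w q ∅ ω * ind Eᶜ ω =
      rcPartitionFunctionW w q ∅ - ∑ ω : BondConfig V, rcWeightW w q ∅ ω * ind E ω := by
  unfold rcPartitionFunctionW
  rw [← Finset.sum_sub_distrib]
  refine Finset.sum_congr rfl fun ω _ => ?_
  by_cases h : ω ∈ E
  · have hc : ω ∉ Eᶜ := fun h' => h' h
    rw [ind_of_mem h, ind_of_not_mem hc]; ring
  · have hc : ω ∈ Eᶜ := h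
    rw [ind_of_not_mem h, ind_of_mem hc]; ring

/-- If `w e = 1` the weight lives on `J_e`: `S_w(J_e ∩ E) = S_w(E)`. [cite: Grimmett2006, §1.4 eq. (1.20) (p. 15)] -/
theorem sum_rcWeightW_ind_inter_openPair_of_one (w : Sym2 V → unitInterval) (q : ℝ) {e : Sym2 V} (h1 : (w e : ℝ) = 1)
    (E : Set (BondConfig V)) :
    ∑ ω : BondConfig V, rcWeightW w q ∅ ω * ind ({ω | e ∈ ω} ∩ E) ω = ∑ ω : BondConfig V, rcWeightW w q ∅ ω * ind E ω := by
  refine Finset.sum_congr rfl fun ω _ => ?_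
  by_cases he : e ∈ ω
  · by_cases hE : ω ∈ E
    · have h2 : ω ∈ ({ω | e ∈ ω} ∩ E : Set (BondConfig V)) := ⟨he, hE⟩
      rw [ind_of_mem h2, ind_of_mem hE]
    · have h2 : ω ∉ ({ω | e ∈ ω} ∩ E : Set (BondConfig V)) := fun h => hE h.2
      rw [ind_of_not_mem h2, ind_of_not_mem hE]
  · rw [rcWeightW_eq_zero_of_one_not_mem w q ∅ h1 he, zero_mul, zero_mul]

/-- If `w e = 0` the weight vanishes on `J_e`: `S_w(J_e ∩ E) = 0`. [cite: Grimmett2006, §1.4 eq. (1.20) (p. 15)] -/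
theorem sum_rcWeightW_ind_inter_openPair_of_zero (w : Sym2 V → unitInterval) (q : ℝ) {e : Sym2 V} (h0 : (w e : ℝ) = 0)
    (E : Set (BondConfig V)) :
    ∑ ω : BondConfig V, rcWeightW w q ∅ ω * ind ({ω | e ∈ ω} ∩ E) ω = 0 := by
  refine Finset.sum_eq_zero fun ω _ => ?_
  by_cases he : e ∈ ω
  · rw [rcWeightW_eq_zero_of_zero_mem w q ∅ h0 he, zero_mul]
  · have h2 : ω ∉ ({ω | e ∈ ω} ∩ E : Set (BondConfig V)) := fun h => he h.1
    rw [ind_of_not_mem h2, mul_zero]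

/-- One-edge decomposition of `S_w(J_f ∩ E)`: only the contraction corner survives, `S_w(J_f ∩ E) = (w f)·S_{w[f↦1]}(E)`.
[cite: Grimmett2006, §1.4 eq. (1.20) (p. 15); Thm. (3.1)(a) (p. 37)] -/
theorem sum_rcWeightW_ind_inter_openPair (w : Sym2 V → unitInterval) (q : ℝ) (f : Sym2 V) (E : Set (BondConfig V)) :
    ∑ ω : BondConfig V, rcWeightW w q ∅ ω * ind ({ω | f ∈ ω} ∩ E) ω =
      (w f : ℝ) * ∑ ω : BondConfig V, rcWeightW (Function.update w f 1) q ∅ ω * ind E ω := by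
  rw [sum_rcWeightW_ind_affine w q f,
    sum_rcWeightW_ind_inter_openPair_of_zero (Function.update w f 0) q (e := f) (by simp) E,
    sum_rcWeightW_ind_inter_openPair_of_one (Function.update w f 1) q (e := f) (by simp) E]
  ring

/-- `S_w(J_f) = (w f)·Z_{w[f↦1]}`. [cite: Grimmett2006, §1.4 eq. (1.20) (p. 15); Thm. (3.1)(a) (p. 37)] -/
theorem sum_rcWeightW_ind_openPair (w : Sym2 V → unitInterval) (q : ℝ) (f : Sym2 V) :
    ∑ ω : BondConfig V, rcWeightW w q ∅ ω * ind {ω | f ∈ ω} ω = (w f : ℝ) * rcPartitionFunctionW (Function.update w f 1) q ∅ := by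
  have h := sum_rcWeightW_ind_inter_openPair w q f Set.univ
  rw [Set.inter_univ] at h
  rw [h]
  congr 1
  unfold rcPartitionFunctionW
  refine Finset.sum_congr rfl fun ω _ => ?_
  rw [ind_of_mem (Set.mem_univ _), mul_one]

/-- With the pair `e = s(x,y)` almost surely open, `x ↮ y` has mass zero: `S_{w[e↦1]}(x ↮ y) = 0`. [folklore] -/
theorem sum_rcWeightW_update_one_compl_openConn (w : Sym2 V → unitInterval) (q : ℝ) (x y : V) :
    ∑ ω : BondConfig V, rcWeightW (Function.update w s(x, y) 1) q ∅ ω * ind (openConn x y : Set (BondConfig V))ᶜ ω = 0 := by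
  refine Finset.sum_eq_zero fun ω _ => ?_
  by_cases he : s(x, y) ∈ ω
  · have hxy : ω ∈ openConn x y := by
      by_cases h : x = y
      · rw [← h]; exact (mem_openConn_iff' x x ω).2 (SimpleGraph.Reachable.refl x)
      · exact (mem_openConn_iff' x y ω).2
          (SimpleGraph.Adj.reachable (G := openGraph ω) ((SimpleGraph.fromEdgeSet_adj _).2 ⟨he, h⟩))
    have hc : ω ∉ (openConn x y : Set (BondConfig V))ᶜ := fun h => h hxy
    rw [ind_of_not_mem hc, mul_zero]
  · rw [rcWeightW_eq_zero_of_one_not_mem (Function.update w s(x, y) 1) q ∅ (by simp) he, zero_mul]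

/-! ### The toggle `ω ↦ ω ∆ {e}`: opening `e = s(x,y)` costs a factor `1` or `q⁻¹` -/

/-- **Opening the pair `e = s(x,y)`** (`e ∉ ω`): `w_q[e↦1](ω ∪ {e}) = w_q[e↦0](ω)·(1 + (q⁻¹ − 1)·1{x ↮ y in ω})` — the edge factors
agree and the cluster count drops by one exactly when `x, y` were not yet joined. [cite: Grimmett2006, Thm. (3.1)(a) (p. 37); §1.4 eq. (1.20)] -/
theorem rcWeightW_update_one_insert (w : Sym2 V → unitInterval) {q : ℝ} (hq : q ≠ 0) {x y : V}
    {ω : BondConfig V} (he : s(x, y) ∉ ω) :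
    rcWeightW (Function.update w s(x, y) 1) q ∅ (insert s(x, y) ω) =
      rcWeightW (Function.update w s(x, y) 0) q ∅ ω * (1 + (q⁻¹ - 1) * ind (openConn x y : Set (BondConfig V))ᶜ ω) := by
  -- the edge factors agree
  have hprod : BHK2006.weight (fun f => ((Function.update w s(x, y) 1 f : unitInterval) : ℝ)) (insert s(x, y) ω) =
      BHK2006.weight (fun f => ((Function.update w s(x, y) 0 f : unitInterval) : ℝ)) ω := by
    unfold BHK2006.weight
    refine Finset.prod_congr rfl fun f _ => ?_
    dsimp only
    by_cases hfe : f = s(x, y)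
    · subst hfe
      simp [he]
    · rw [Function.update_of_ne hfe, Function.update_of_ne hfe]
      have : f ∈ insert s(x, y) ω ↔ f ∈ ω := by simp [hfe]
      simp only [this]
  unfold rcWeightW
  rw [hprod]
  -- the cluster counts
  have hgraph : openGraph (insert s(x, y) ω) ⊔ wired (∅ : Set V) = (openGraph ω ⊔ wired (∅ : Set V)) ⊔ SimpleGraph.edge x y := by
    change SimpleGraph.fromEdgeSet (insert s(x, y) ω) ⊔ wired ∅ = _
    rw [Set.insert_eq, SimpleGraph.fromEdgeSet_union, sup_comm (SimpleGraph.fromEdgeSet {s(x, y)}), sup_right_comm]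
    rfl
  by_cases hreach : ω ∈ openConn x y
  · have hreach' : (openGraph ω ⊔ wired (∅ : Set V)).Reachable x y := by
      rw [wired_empty, sup_bot_eq]; exact hreach
    have hk : clusterCount (insert s(x, y) ω) ∅ = clusterCount ω ∅ := by
      unfold clusterCount
      rw [hgraph]
      exact card_connectedComponent_sup_edge_of_reachable _ hreach'
    have hc : ω ∉ (openConn x y : Set (BondConfig V))ᶜ := fun h => h hreach
    rw [hk, ind_of_not_mem hc]
    ring
  · have hreach' : ¬ (openGraph ω ⊔ wired (∅ : Set V)).Reachable x y := by
      rw [wired_empty, sup_bot_eq]; exact hreach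
    have hk : clusterCount ω ∅ = clusterCount (insert s(x, y) ω) ∅ + 1 := by
      unfold clusterCount
      rw [hgraph]
      have h1 := card_connectedComponent_sup_edge_lt _ hreach'
      have h2 := card_connectedComponent_le_sup_edge_add_one (openGraph ω ⊔ wired (∅ : Set V)) x y
      omega
    have hc : ω ∈ (openConn x y : Set (BondConfig V))ᶜ := hreach
    rw [hk, ind_of_mem hc, pow_succ, mul_one, add_sub_cancel]
    field_simp

/-- **Toggle identity**: for every event `F` that does not depend on the pair `e = s(x,y)`,
`S_{w[e↦1]}(F) = S_{w[e↦0]}(F) + (q⁻¹ − 1)·S_{w[e↦0]}(F ∩ {x ↮ y})` (substitute `ω ↦ ω ∆ {e}`).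
[cite: Grimmett2006, Thm. (3.1)(a) (p. 37); §1.4 eq. (1.20) (p. 15)] -/
theorem sum_rcWeightW_update_one_eq_toggle (w : Sym2 V → unitInterval) {q : ℝ} (hq : q ≠ 0) (x y : V)
    (F : Set (BondConfig V)) (hF : ∀ ω : BondConfig V, ω ∆ {s(x, y)} ∈ F ↔ ω ∈ F) :
    ∑ ω : BondConfig V, rcWeightW (Function.update w s(x, y) 1) q ∅ ω * ind F ω =
      ∑ ω : BondConfig V, rcWeightW (Function.update w s(x, y) 0) q ∅ ω * ind F ω +
        (q⁻¹ - 1) * ∑ ω : BondConfig V, rcWeightW (Function.update w s(x, y) 0) q ∅ ω *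
          ind (F ∩ (openConn x y : Set (BondConfig V))ᶜ) ω := by
  let σ : Equiv.Perm (BondConfig V) := Function.Involutive.toPerm (fun ω : BondConfig V => ω ∆ {s(x, y)})
    (symmDiff_left_involutive {s(x, y)})
  calc ∑ ω : BondConfig V, rcWeightW (Function.update w s(x, y) 1) q ∅ ω * ind F ω
      = ∑ ω : BondConfig V, rcWeightW (Function.update w s(x, y) 1) q ∅ (σ ω) * ind F (σ ω) :=
        (Equiv.sum_comp σ (fun ω => rcWeightW (Function.update w s(x, y) 1) q ∅ ω * ind F ω)).symm
    _ = ∑ ω : BondConfig V, (rcWeightW (Function.update w s(x, y) 0) q ∅ ω * ind F ω +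
          (q⁻¹ - 1) * (rcWeightW (Function.update w s(x, y) 0) q ∅ ω *
            ind (F ∩ (openConn x y : Set (BondConfig V))ᶜ) ω)) := by
        refine Finset.sum_congr rfl fun ω _ => ?_
        change rcWeightW (Function.update w s(x, y) 1) q ∅ (ω ∆ {s(x, y)}) * ind F (ω ∆ {s(x, y)}) = _
        have hindF : ind F (ω ∆ {s(x, y)}) = ind F ω := by
          by_cases h : ω ∈ F
          · rw [ind_of_mem h, ind_of_mem ((hF ω).2 h)]
          · rw [ind_of_not_mem h, ind_of_not_mem (fun h' => h ((hF ω).1 h'))]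
        rw [hindF]
        by_cases heω : s(x, y) ∈ ω
        · -- `e` gets closed: both sides vanish
          have hnot : s(x, y) ∉ ω ∆ {s(x, y)} := by simp [Set.mem_symmDiff, heω]
          rw [rcWeightW_eq_zero_of_one_not_mem (Function.update w s(x, y) 1) q ∅ (by simp) hnot,
            rcWeightW_eq_zero_of_zero_mem (Function.update w s(x, y) 0) q ∅ (by simp) heω]
          ring
        · -- `e` gets opened
          have hins : ω ∆ {s(x, y)} = insert s(x, y) ω := by
            ext f
            simp only [Set.mem_symmDiff, Set.mem_singleton_iff, Set.mem_insert_iff]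
            constructor
            · rintro (⟨hf, -⟩ | ⟨rfl, -⟩)
              · exact Or.inr hf
              · exact Or.inl rfl
            · rintro (rfl | hf)
              · exact Or.inr ⟨rfl, heω⟩
              · exact Or.inl ⟨hf, fun h => heω (h ▸ hf)⟩
          rw [hins, rcWeightW_update_one_insert w hq heω, ← ind_mul_ind F]
          ring
    _ = _ := by rw [Finset.sum_add_distrib, ← Finset.mul_sum]

/-- `Z_{w[e↦1]} = Z_{w[e↦0]} + (q⁻¹ − 1)·S_{w[e↦0]}(x ↮ y)` for `e = s(x,y)`. [cite: Grimmett2006, Thm. (3.1)(a) (p. 37)] -/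
theorem rcPartitionFunctionW_update_one_eq_toggle (w : Sym2 V → unitInterval) {q : ℝ} (hq : q ≠ 0) (x y : V) :
    rcPartitionFunctionW (Function.update w s(x, y) 1) q ∅ = rcPartitionFunctionW (Function.update w s(x, y) 0) q ∅ +
      (q⁻¹ - 1) * ∑ ω : BondConfig V, rcWeightW (Function.update w s(x, y) 0) q ∅ ω *
        ind (openConn x y : Set (BondConfig V))ᶜ ω := by
  have h := sum_rcWeightW_update_one_eq_toggle w hq x y Set.univ (fun ω => by simp)
  simp only [ind_of_mem (Set.mem_univ _), mul_one, Set.univ_inter] at h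
  exact h

/-! ### The master identity: covariance of two edges = −(positive factor)·(single-edge increment of a connection probability) -/

/-- **Master identity** (any `q ≠ 0`): for `e = s(x,y)` with `x ≠ y`, `f ≠ e`, `c = w e`, `d = w f`,
`S_w(J_e ∩ J_f)·Z_w − S_w(J_e)·S_w(J_f) = c(1−c)d(1−d)(q⁻¹−1)·[S_{w[e↦0][f↦1]}(x↮y)·Z_{w[e↦0][f↦0]} − S_{w[e↦0][f↦0]}(x↮y)·Z_{w[e↦0][f↦1]}]`.
So for `q < 1` the covariance of the two edges is `≤ 0` iff opening `f` (with `e` closed) does not lower `φ(x ↔ y)`.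
[cite: Grimmett2006, §3.9 eq. (3.94) (p. 63); Thm. (3.1)(a) (p. 37)] -/
theorem negCorr_defect_eq (w : Sym2 V → unitInterval) {q : ℝ} (hq : q ≠ 0) (x y : V) {f : Sym2 V}
    (hfe : f ≠ s(x, y)) :
    (∑ ω : BondConfig V, rcWeightW w q ∅ ω * ind ({ω | s(x, y) ∈ ω} ∩ {ω | f ∈ ω}) ω) * rcPartitionFunctionW w q ∅ -
        (∑ ω : BondConfig V, rcWeightW w q ∅ ω * ind {ω | s(x, y) ∈ ω} ω) *
          (∑ ω : BondConfig V, rcWeightW w q ∅ ω * ind {ω | f ∈ ω} ω) =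
      (w s(x, y) : ℝ) * (1 - (w s(x, y) : ℝ)) * ((w f : ℝ) * (1 - (w f : ℝ))) * (q⁻¹ - 1) *
        ((∑ ω : BondConfig V, rcWeightW (Function.update (Function.update w s(x, y) 0) f 1) q ∅ ω *
              ind (openConn x y : Set (BondConfig V))ᶜ ω) *
            rcPartitionFunctionW (Function.update (Function.update w s(x, y) 0) f 0) q ∅ -
          (∑ ω : BondConfig V, rcWeightW (Function.update (Function.update w s(x, y) 0) f 0) q ∅ ω *
              ind (openConn x y : Set (BondConfig V))ᶜ ω) *
            rcPartitionFunctionW (Function.update (Function.update w s(x, y) 0) f 1) q ∅) := by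
  -- STEP 1: decompose at `e`
  have s1 := sum_rcWeightW_ind_inter_openPair w q s(x, y) ({ω | f ∈ ω} : Set (BondConfig V))
  have s2 := sum_rcWeightW_ind_openPair w q s(x, y)
  have s3 := sum_rcWeightW_ind_affine w q s(x, y) ({ω | f ∈ ω} : Set (BondConfig V))
  have s4 := rcPartitionFunctionW_affine w q s(x, y)
  -- STEP 2: toggle at `e` (the events `J_f` and `univ` do not depend on `e`)
  have hF : ∀ ω : BondConfig V, ω ∆ {s(x, y)} ∈ ({ω | f ∈ ω} : Set (BondConfig V)) ↔
      ω ∈ ({ω | f ∈ ω} : Set (BondConfig V)) := by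
    intro ω
    simp only [Set.mem_setOf_eq, Set.mem_symmDiff, Set.mem_singleton_iff, hfe, not_false_eq_true, and_true, false_and,
      or_false]
  have t1 := sum_rcWeightW_update_one_eq_toggle w hq x y _ hF
  have t2 := rcPartitionFunctionW_update_one_eq_toggle w hq x y
  -- STEP 3: decompose at `f` in the state `w[e↦0]`
  have u1 := sum_rcWeightW_ind_inter_openPair (Function.update w s(x, y) 0) q f (openConn x y : Set (BondConfig V))ᶜ
  have u2 := sum_rcWeightW_ind_openPair (Function.update w s(x, y) 0) q f
  have u3 := sum_rcWeightW_ind_affine (Function.update w s(x, y) 0) q f (openConn x y : Set (BondConfig V))ᶜ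
  have u4 := rcPartitionFunctionW_affine (Function.update w s(x, y) 0) q f
  rw [Function.update_of_ne hfe] at u1 u2 u3 u4
  rw [s1, s2, s3, s4, t1, t2, u1, u2, u3, u4]
  ring

/-! ### Lifting from `w e = 0` to general weights -/

/-- **`x ↮ y` masses with the pair `e = s(x,y)` present**: `S_w(x↮y) = (1 − w e)·S_{w[e↦0]}(x↮y)` and
`Z_w = Z_{w[e↦0]} + (w e)(q⁻¹ − 1)·S_{w[e↦0]}(x↮y)`. [cite: Grimmett2006, Thm. (3.1)(a) (p. 37); §1.4 eq. (1.20) (p. 15)] -/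
theorem compl_openConn_mass_eq (w : Sym2 V → unitInterval) {q : ℝ} (hq : q ≠ 0) (x y : V) :
    (∑ ω : BondConfig V, rcWeightW w q ∅ ω * ind (openConn x y : Set (BondConfig V))ᶜ ω =
        (1 - (w s(x, y) : ℝ)) * ∑ ω : BondConfig V, rcWeightW (Function.update w s(x, y) 0) q ∅ ω *
          ind (openConn x y : Set (BondConfig V))ᶜ ω) ∧
      rcPartitionFunctionW w q ∅ = rcPartitionFunctionW (Function.update w s(x, y) 0) q ∅ +
        (w s(x, y) : ℝ) * (q⁻¹ - 1) * ∑ ω : BondConfig V, rcWeightW (Function.update w s(x, y) 0) q ∅ ω *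
          ind (openConn x y : Set (BondConfig V))ᶜ ω := by
  constructor
  · rw [sum_rcWeightW_ind_affine w q s(x, y), sum_rcWeightW_update_one_compl_openConn w q x y]
    ring
  · rw [rcPartitionFunctionW_affine w q s(x, y), rcPartitionFunctionW_update_one_eq_toggle w hq x y]
    ring

/-- EC⁺ in `x ↮ y` form, LIFTED: if opening `f` does not raise the `x ↮ y` mass fraction in the state with `e = s(x,y)` closed,
then it does not in the state `w` either (`f ≠ e`, any `q > 0`). [cite: Grimmett2006, Thm. (3.1)(a) (p. 37)] -/
theorem compl_openConn_mono_lift (w : Sym2 V → unitInterval) {q : ℝ} (hq : 0 < q) (x y : V) {f : Sym2 V}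
    (hfe : f ≠ s(x, y))
    (h : (∑ ω : BondConfig V, rcWeightW (Function.update (Function.update w s(x, y) 0) f 1) q ∅ ω *
            ind (openConn x y : Set (BondConfig V))ᶜ ω) *
          rcPartitionFunctionW (Function.update (Function.update w s(x, y) 0) f 0) q ∅ ≤
        (∑ ω : BondConfig V, rcWeightW (Function.update (Function.update w s(x, y) 0) f 0) q ∅ ω *
            ind (openConn x y : Set (BondConfig V))ᶜ ω) *
          rcPartitionFunctionW (Function.update (Function.update w s(x, y) 0) f 1) q ∅) :
    (∑ ω : BondConfig V, rcWeightW (Function.update w f 1) q ∅ ω * ind (openConn x y : Set (BondConfig V))ᶜ ω) *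
        rcPartitionFunctionW (Function.update w f 0) q ∅ ≤
      (∑ ω : BondConfig V, rcWeightW (Function.update w f 0) q ∅ ω * ind (openConn x y : Set (BondConfig V))ᶜ ω) *
        rcPartitionFunctionW (Function.update w f 1) q ∅ := by
  have hq0 : q ≠ 0 := hq.ne'
  obtain ⟨a1, z1⟩ := compl_openConn_mass_eq (Function.update w f 1) hq0 x y
  obtain ⟨a0, z0⟩ := compl_openConn_mass_eq (Function.update w f 0) hq0 x y
  rw [Function.update_of_ne hfe.symm, Function.update_comm hfe] at a1 z1 a0 z0
  rw [a1, z1, a0, z0]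
  have hc0 : 0 ≤ ((w s(x, y) : unitInterval) : ℝ) := (w s(x, y)).2.1
  have hc1 : ((w s(x, y) : unitInterval) : ℝ) ≤ 1 := (w s(x, y)).2.2
  have h1c : 0 ≤ 1 - ((w s(x, y) : unitInterval) : ℝ) := by linarith
  nlinarith [mul_nonneg h1c (sub_nonneg.2 h)]

/-! ### EC⁺ ⟺ edge-negative association (`0 < q < 1`) -/

/-- EC⁺ between the two pinned measures in `x ↮ y` mass form. [cite: Grimmett2006, §1.4 eq. (1.20) (p. 15)] -/
theorem edgeConnMono_iff_compl_mass {w₀ w₁ : Sym2 V → unitInterval} {q : ℝ} (hq : 0 < q) (x y : V) :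
    (rcMeasureW w₀ q ∅).real (openConn x y) ≤ (rcMeasureW w₁ q ∅).real (openConn x y) ↔
      (∑ ω : BondConfig V, rcWeightW w₁ q ∅ ω * ind (openConn x y : Set (BondConfig V))ᶜ ω) * rcPartitionFunctionW w₀ q ∅ ≤
        (∑ ω : BondConfig V, rcWeightW w₀ q ∅ ω * ind (openConn x y : Set (BondConfig V))ᶜ ω) *
          rcPartitionFunctionW w₁ q ∅ := by
  rw [real_le_real_iff_mass hq, sum_rcWeightW_ind_compl w₁ q, sum_rcWeightW_ind_compl w₀ q]
  constructor <;> intro h <;> nlinarith [h]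

/-! ### Appendix (same generation): the general edge ↔ connection duality for `q ≠ 1` -/

/-- `S_w(F ∩ Aᶜ) = S_w(F) − S_w(F ∩ A)`. [cite: Grimmett2006, §1.4 eq. (1.20) (p. 15)] -/
theorem sum_rcWeightW_ind_inter_compl (w : Sym2 V → unitInterval) (q : ℝ) (F A : Set (BondConfig V)) :
    ∑ ω : BondConfig V, rcWeightW w q ∅ ω * ind (F ∩ Aᶜ) ω =
      ∑ ω : BondConfig V, rcWeightW w q ∅ ω * ind F ω - ∑ ω : BondConfig V, rcWeightW w q ∅ ω * ind (F ∩ A) ω := by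
  rw [← Finset.sum_sub_distrib]
  refine Finset.sum_congr rfl fun ω _ => ?_
  rw [← ind_mul_ind F Aᶜ, ← ind_mul_ind F A]
  by_cases h : ω ∈ A
  · have hc : ω ∉ Aᶜ := fun h' => h' h
    rw [ind_of_mem h, ind_of_not_mem hc]; ring
  · have hc : ω ∈ Aᶜ := h
    rw [ind_of_not_mem h, ind_of_mem hc]; ring

/-- **Edge ↔ connection duality** (any `q ≠ 0`): for the pair `e = s(x,y)` with parameter `c = w e` and ANY event `F` that does
not depend on `e`, the unnormalised covariance of `J_e` with `F` is `−c(1−c)(q⁻¹−1)` times the unnormalised covariance of the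
connection event `{x ↔ y}` with `F` in the state with `e` closed:
`S_w(J_e ∩ F)·Z_w − S_w(J_e)·S_w(F) = −c(1−c)(q⁻¹ − 1)·[S_{w[e↦0]}({x↔y} ∩ F)·Z_{w[e↦0]} − S_{w[e↦0]}(x↔y)·S_{w[e↦0]}(F)]`.
So for `q < 1` an edge is NEGATIVELY correlated with an `e`-insensitive event exactly when the connection it would create is
POSITIVELY correlated with that event one edge down: `F = J_f` gives EC⁺ ⟺ edge-negative association (`negCorr_defect_eq`),
`F = {u ↔ v off e}` shows that pairwise positive correlation of connection events is itself a single-edge negative-association statement.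
[cite: Grimmett2006, §3.9 (pp. 63–64); Thm. (3.1)(a) (p. 37)] -/
theorem openPair_defect_eq_neg_conn_defect (w : Sym2 V → unitInterval) {q : ℝ} (hq : q ≠ 0) (x y : V)
    (F : Set (BondConfig V)) (hF : ∀ ω : BondConfig V, ω ∆ {s(x, y)} ∈ F ↔ ω ∈ F) :
    (∑ ω : BondConfig V, rcWeightW w q ∅ ω * ind ({ω | s(x, y) ∈ ω} ∩ F) ω) * rcPartitionFunctionW w q ∅ -
        (∑ ω : BondConfig V, rcWeightW w q ∅ ω * ind {ω | s(x, y) ∈ ω} ω) *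
          (∑ ω : BondConfig V, rcWeightW w q ∅ ω * ind F ω) =
      -((w s(x, y) : ℝ) * (1 - (w s(x, y) : ℝ)) * (q⁻¹ - 1)) *
        ((∑ ω : BondConfig V, rcWeightW (Function.update w s(x, y) 0) q ∅ ω * ind (F ∩ openConn x y) ω) *
            rcPartitionFunctionW (Function.update w s(x, y) 0) q ∅ -
          (∑ ω : BondConfig V, rcWeightW (Function.update w s(x, y) 0) q ∅ ω * ind (openConn x y) ω) *
            (∑ ω : BondConfig V, rcWeightW (Function.update w s(x, y) 0) q ∅ ω * ind F ω)) := by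
  have s1 := sum_rcWeightW_ind_inter_openPair w q s(x, y) F
  have s2 := sum_rcWeightW_ind_openPair w q s(x, y)
  have s3 := sum_rcWeightW_ind_affine w q s(x, y) F
  have s4 := rcPartitionFunctionW_affine w q s(x, y)
  have t1 := sum_rcWeightW_update_one_eq_toggle w hq x y F hF
  have t2 := rcPartitionFunctionW_update_one_eq_toggle w hq x y
  have c1 := sum_rcWeightW_ind_inter_compl (Function.update w s(x, y) 0) q F (openConn x y)
  have c2 := sum_rcWeightW_ind_compl (Function.update w s(x, y) 0) q (openConn x y : Set (BondConfig V))
  rw [s1, s2, s3, s4, t1, t2, c1, c2]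
  ring

end FK

end Summit.CriticalPhenomena.PercolationContinuityZ3.Theorems

end
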